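import Literature.Geometry.Lorentzian.BackgroundChartCalculus
import Literature.Geometry.Lorentzian.NearMinkowskiChart
import HarnessLib

/-!
# Pointed `Cᵏ_loc` subconvergence to a near-Minkowski chart spacetime from converging charts

The GEOMETRIC half of the local (one-chart) Cheeger–Gromov compactness theorem for pointed
spacetimes (Petersen 2006, Ch. 10, §3.2, the step "the limit charts define the limit metric and the
chart maps are the comparison maps"): let `(𝓢ₙ, pₙ)` be pointed spacetimes carrying smooth injective
chart maps `Ψₙ : ↥O → 𝓢ₙ` on a common connected open set `O ⊆ E4`, centred (`Ψₙ y₀ = pₙ`),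
`C⁰`-PINCHED (`‖Ψₙ^* gₙ − η‖ < 1` on `O`) and pushing `∂₀` to the future at the centre. If along a
subsequence `φ` the metric components `Ψ_{φ m}^* g_{φ m}` converge in `Cᵏ` on every compact subset
of `O` to a near-Minkowski field `G` (`NearMinkowskiChart O`), then

  `(𝓢ₙ, pₙ) ⇀ ((O, G, ∂₀), y₀)` in the pointed `Cᵏ_loc` sense (`Spacetime.SubconvergesLocallyTo`),

with comparison maps the chart maps themselves (`LocalSubconvergence.ofCharts`): they are local
diffeomorphisms because pinched charts are immersions (`BackgroundChartCalculus.lean`), they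
preserve the time orientations because a pinched chart is oriented by its centre, and the
convergence clause is the hypothesis read through `metricInCoords_chartAt_symm`. No covering
condition is part of `SubconvergesLocallyTo`, so the one-chart limit is a limit. The ANALYTIC half
— extracting `φ` and `G` from uniform all-orders bounds by Arzelà–Ascoli — is
`TameChartCompactness.lean`.

## References
* P. Petersen, *Riemannian Geometry*, 2nd ed., GTM 171, Springer 2006, Ch. 10, §3.2. [Petersen2006]
* M. T. Anderson, Cheeger–Gromov theory and applications to general relativity, in *The Einstein
  equations and the large scale behavior of gravitational fields*, Birkhäuser 2004, Def. 1.1. [Anderson2004]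
-/

noncomputable section

open Set Filter TopologicalSpace Function
open scoped Manifold ContDiff Topology ENNReal

universe u

namespace Literature.Geometry.Lorentzian

namespace Spacetime

namespace LocalSubconvergence

variable {𝓢ₙ : ℕ → Spacetime.{u} 4} {pₙ : ∀ n, (𝓢ₙ n).carrier} {O : Opens E4}

/-- **The subconvergence datum defined by converging pinched charts** (module docstring):
subsequence `φ`, exhaustion of `↥O` by the interiors of a compact exhaustion, comparison maps the
chart maps `Ψ_{φ m}`. [cite: Petersen2006, Ch. 10 §3.2] -/
def ofCharts (hO : IsConnected (O : Set E4)) {y₀ : E4} (hy₀ : y₀ ∈ (O : Set E4))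
    (Ψ : ∀ n, O → (𝓢ₙ n).carrier) (hΨ : ∀ n, ContMDiff 𝓘(ℝ, E4) (𝓡 4) ∞ (Ψ n))
    (hinj : ∀ n, Injective (Ψ n)) (hcentre : ∀ n, Ψ n ⟨y₀, hy₀⟩ = pₙ n)
    (hfut : ∀ n, (𝓢ₙ n).timeOrientation.IsFutureDirected
      (mfderiv 𝓘(ℝ, E4) (𝓡 4) (Ψ n) ⟨y₀, hy₀⟩ (E4.basisVector 0)))
    (hpinch : ∀ n, ∀ y ∈ (O : Set E4),
      ‖(𝓢ₙ n).deviationExtend (Minkowski.backgroundOn O) (Ψ n) y‖ < 1)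
    (L : NearMinkowskiChart O) {φ : ℕ → ℕ} (hφ : StrictMono φ) (k : ℕ)
    (hlim : ∀ K ⊆ (O : Set E4), IsCompact K →
      Tendsto (fun m ↦ supCkENorm K k
        ((𝓢ₙ (φ m)).metricInCoords (Ψ (φ m) ∘ (chartAt E4 (⟨y₀, hy₀⟩ : O)).symm) - L.G))
        atTop (𝓝 0)) :
    LocalSubconvergence 𝓢ₙ pₙ (L.spacetime hO) ⟨y₀, hy₀⟩ k where
  sub := φ
  strictMono_sub := hφ
  U := reflOpens (L.spacetime hO) ⟨y₀, hy₀⟩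
  monotone_U _ _ hmn _ hx :=
    interior_mono ((compactExhaustion (L.spacetime hO)).subset (Nat.add_le_add_right hmn _)) hx
  mem_U := (compactExhaustion (L.spacetime hO)).subset_interior (by omega)
    ((compactExhaustion (L.spacetime hO)).mem_find _)
  iUnion_U := eq_univ_of_forall fun x ↦ mem_iUnion.2
    ⟨(compactExhaustion (L.spacetime hO)).find x + 1,
      (compactExhaustion (L.spacetime hO)).subset_interior (by omega)
        ((compactExhaustion (L.spacetime hO)).mem_find x)⟩
  isCompact_closure_U _ :=
    ((compactExhaustion (L.spacetime hO)).isCompact _).closure_of_subset interior_subset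
  embed m := Ψ (φ m)
  isLocalDiffeomorphOn_embed m :=
    ((𝓢ₙ (φ m)).isLocalDiffeomorph_of_norm_deviationExtend_lt_one (Ψ (φ m)) (hΨ _)
      (hpinch _)).isLocalDiffeomorphOn _
  injOn_embed m := (hinj (φ m)).injOn
  embed_basepoint m := hcentre (φ m)
  isFutureDirected_mfderiv_embed m x _ :=
    (𝓢ₙ (φ m)).isFutureDirected_mfderiv_basisVector_zero_of_norm_deviationExtend_lt_one
      hO.isPreconnected (Ψ (φ m)) (hΨ _) (hpinch _) (hfut (φ m)) x
  tendsto_supCkENorm x K hK hKt := by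
    have hKO : K ⊆ (O : Set E4) := by
      have h : (chartAt E4 x).target = (O : Set E4) := OpensChart.chartAt_target x
      exact hKt.trans h.subset
    have heq : ∀ m, supCkENorm K k
        ((𝓢ₙ (φ m)).metricInCoords (Ψ (φ m) ∘ (chartAt E4 x).symm) -
          (L.spacetime hO).metricInCoords (chartAt E4 x).symm) =
        supCkENorm K k ((𝓢ₙ (φ m)).metricInCoords (Ψ (φ m) ∘ (chartAt E4 (⟨y₀, hy₀⟩ : O)).symm)
          - L.G) := fun m ↦ by
      refine supCkENorm_congr fun y hy ↦ ?_
      filter_upwards [O.2.mem_nhds (hKO hy)] with z hz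
      have h1 : (L.spacetime hO).metricInCoords (chartAt E4 x).symm z = L.G z :=
        L.metricInCoords_chartAt_symm hO x hz
      -- all preferred charts of `↥O` are the same inclusion (definitionally)
      show (𝓢ₙ (φ m)).metricInCoords (Ψ (φ m) ∘ (chartAt E4 (⟨y₀, hy₀⟩ : O)).symm) z -
          (L.spacetime hO).metricInCoords (chartAt E4 x).symm z =
        (𝓢ₙ (φ m)).metricInCoords (Ψ (φ m) ∘ (chartAt E4 (⟨y₀, hy₀⟩ : O)).symm) z - L.G z
      rw [h1]
    exact (hlim K hKO hK).congr fun m ↦ (heq m).symm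

end LocalSubconvergence

/-- **Pointed `Cᵏ_loc` subconvergence to the near-Minkowski chart spacetime of the limit
components** (module docstring). [cite: Petersen2006, Ch. 10 §3.2] -/
theorem SubconvergesLocallyTo.ofCharts {𝓢ₙ : ℕ → Spacetime.{u} 4} {pₙ : ∀ n, (𝓢ₙ n).carrier}
    {O : Opens E4} (hO : IsConnected (O : Set E4)) {y₀ : E4} (hy₀ : y₀ ∈ (O : Set E4))
    (Ψ : ∀ n, O → (𝓢ₙ n).carrier) (hΨ : ∀ n, ContMDiff 𝓘(ℝ, E4) (𝓡 4) ∞ (Ψ n))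
    (hinj : ∀ n, Injective (Ψ n)) (hcentre : ∀ n, Ψ n ⟨y₀, hy₀⟩ = pₙ n)
    (hfut : ∀ n, (𝓢ₙ n).timeOrientation.IsFutureDirected
      (mfderiv 𝓘(ℝ, E4) (𝓡 4) (Ψ n) ⟨y₀, hy₀⟩ (E4.basisVector 0)))
    (hpinch : ∀ n, ∀ y ∈ (O : Set E4),
      ‖(𝓢ₙ n).deviationExtend (Minkowski.backgroundOn O) (Ψ n) y‖ < 1)
    (L : NearMinkowskiChart O) {φ : ℕ → ℕ} (hφ : StrictMono φ) {k : ℕ}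
    (hlim : ∀ K ⊆ (O : Set E4), IsCompact K →
      Tendsto (fun m ↦ supCkENorm K k
        ((𝓢ₙ (φ m)).metricInCoords (Ψ (φ m) ∘ (chartAt E4 (⟨y₀, hy₀⟩ : O)).symm) - L.G))
        atTop (𝓝 0)) :
    SubconvergesLocallyTo 𝓢ₙ pₙ (L.spacetime hO) ⟨y₀, hy₀⟩ k :=
  ⟨LocalSubconvergence.ofCharts hO hy₀ Ψ hΨ hinj hcentre hfut hpinch L hφ k hlim⟩

/-- **Deviation form of the convergence hypothesis.** The clause of `SubconvergesLocallyTo.ofCharts`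
holds as soon as the DEVIATIONS `Ψ_{φ m}^* g_{φ m} − η` converge in `Cᵏ` on compacts of `O` to
`G − η` (the components and the deviation + `η` have the same germs on `O`). [cite: Petersen2006, Ch. 10 §3.2] -/
theorem tendsto_supCkENorm_metricInCoords_sub_of_deviationExtend {𝓢ₙ : ℕ → Spacetime.{u} 4}
    {O : Opens E4} (Ψ : ∀ n, O → (𝓢ₙ n).carrier) (hΨ : ∀ n, ContMDiff 𝓘(ℝ, E4) (𝓡 4) ∞ (Ψ n))
    (x : O) (G : E4 → E4 →L[ℝ] E4 →L[ℝ] ℝ) {φ : ℕ → ℕ} {k : ℕ} {K : Set E4}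
    (hKO : K ⊆ (O : Set E4))
    (hlim : Tendsto (fun m ↦ supCkENorm K k
      ((𝓢ₙ (φ m)).deviationExtend (Minkowski.backgroundOn O) (Ψ (φ m)) -
        (G - fun _ ↦ Minkowski.bilin))) atTop (𝓝 0)) :
    Tendsto (fun m ↦ supCkENorm K k
      ((𝓢ₙ (φ m)).metricInCoords (Ψ (φ m) ∘ (chartAt E4 x).symm) - G)) atTop (𝓝 0) := by
  refine hlim.congr fun m ↦ supCkENorm_congr fun y hy ↦ ?_
  have h := ((𝓢ₙ (φ m)).metricInCoords_comp_chartAt_symm_sub_eventuallyEq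
    (Minkowski.backgroundOn O) (Ψ (φ m)) x (hΨ _) (hKO hy)).symm
  filter_upwards [h] with z hz
  have hz' : (𝓢ₙ (φ m)).deviationExtend (Minkowski.backgroundOn O) (Ψ (φ m)) z =
      (𝓢ₙ (φ m)).metricInCoords (Ψ (φ m) ∘ (chartAt E4 x).symm) z - Minkowski.bilin := hz
  rw [Pi.sub_apply, Pi.sub_apply, Pi.sub_apply, hz']
  ext v w
  simp only [sub_apply]
  ring

end Spacetime

end Literature.Geometry.Lorentzian

end
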